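import Mathlib
import Summits.Ventures.PercRepro2.TypedDomainInstanceHarris
import Summits.Ventures.PercRepro2.TypedBundleHarris2

/-!
# The twenty-condition domain is not empty: the separator-free 14-edge instance has no (HARRIS-2)
b-pocket either (blind cell PercRepro2, p2 g7, 2026-08-26; the lead's RULING 1 (iii), R-SEP3(6))

On `ends14` (TypedDomainInstanceSep.lean) the path `b–y–a₁` (edges `9, 6`) crosses the doors `{o, a₂}`
(`noPocketOA2_14`) and the path `b–z–a₂` (edges `11, 10`) the doors `{o, a₁}` (`noPocketOA2Mirror14`), so
**`instance20_mem`**: the instance satisfies all twenty conditions of `ResidualCoreNHatCTBRASUDO7SP2H` —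
the witness of the narrowed domain.  Own code; standard axioms.
-/

namespace Summit.Ventures.PercRepro2

open UnionCluster

namespace CovForm

namespace TypedRed

namespace NonVacuity14

open Separated (zF)

/-- No b-pocket on the doors `{o, a₂}`: `y–b` puts `y` on `b`'s side, `y–a₁` on the far side. -/
theorem noPocketOA2_14 : ¬ PocketOA2.HasPocketOA2 ends14 0 1 2 3 4 F14 := by
  rintro ⟨WP, WF, hs⟩
  have hbF : (4 : Fin 9) ∉ WF := fun h => by
    rcases hs.cap 4 hs.bP h with ho | h2
    · exact absurd ho (by decide)
    · exact absurd h2 (by decide)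
  have h1P : (1 : Fin 9) ∉ WP := fun h => by
    rcases hs.cap 1 h hs.a1F with ho | h2
    · exact absurd ho (by decide)
    · exact absurd h2 (by decide)
  have hyP : (7 : Fin 9) ∈ WP := by
    rcases hs.split 9 (zF14 9) with w | w
    · exact (ends_mem_of_within (x := 7) (y := 4) rfl w).1
    · exact absurd (ends_mem_of_within (x := 7) (y := 4) rfl w).2 hbF
  have hyF : (7 : Fin 9) ∈ WF := by
    rcases hs.split 6 (zF14 6) with w | w
    · exact absurd (ends_mem_of_within (x := 7) (y := 1) rfl w).2 h1P
    · exact (ends_mem_of_within (x := 7) (y := 1) rfl w).1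
  rcases hs.cap 7 hyP hyF with h | h <;> exact absurd h (by decide)

/-- No b-pocket on the doors `{o, a₁}` (the root mirror): `z–b` puts `z` on `b`'s side, `z–a₂` on
the far side. -/
theorem noPocketOA2Mirror14 : ¬ PocketOA2.HasPocketOA2 ends14 0 2 1 3 4 F14 := by
  rintro ⟨WP, WF, hs⟩
  have hbF : (4 : Fin 9) ∉ WF := fun h => by
    rcases hs.cap 4 hs.bP h with ho | h1
    · exact absurd ho (by decide)
    · exact absurd h1 (by decide)
  have h2P : (2 : Fin 9) ∉ WP := fun h => by
    rcases hs.cap 2 h hs.a1F with ho | h1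
    · exact absurd ho (by decide)
    · exact absurd h1 (by decide)
  have hzP : (8 : Fin 9) ∈ WP := by
    rcases hs.split 11 (zF14 11) with w | w
    · exact (ends_mem_of_within (x := 8) (y := 4) rfl w).1
    · exact absurd (ends_mem_of_within (x := 8) (y := 4) rfl w).2 hbF
  have hzF : (8 : Fin 9) ∈ WF := by
    rcases hs.split 10 (zF14 10) with w | w
    · exact absurd (ends_mem_of_within (x := 8) (y := 2) rfl w).2 h2P
    · exact (ends_mem_of_within (x := 8) (y := 2) rfl w).1
  rcases hs.cap 8 hzP hzF with h | h <;> exact absurd h (by decide)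

/-- **The twenty-condition domain is not empty.** -/
theorem instance20_mem : ResidualCoreNHatCTBRASUDO7SP2H ends14 0 1 2 3 4 F14 :=
  ⟨instance18_mem, noPocketOA2_14, noPocketOA2Mirror14⟩

end NonVacuity14

end TypedRed

end CovForm

end Summit.Ventures.PercRepro2
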